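import Mathlib.RingTheory.Valuation.ValuationSubring
import Mathlib.RingTheory.DiscreteValuationRing.Basic
import Mathlib.RingTheory.LocalRing.ResidueField.Basic
import Mathlib.LinearAlgebra.Dimension.Finrank
import Mathlib.Data.Finsupp.Basic
import Mathlib.Algebra.BigOperators.Finsupp.Basic
import Mathlib.RingTheory.AlgebraicIndependent.Basic
import Mathlib.FieldTheory.IntermediateField.Adjoin.Defs
import HarnessLib

-- provenance: harness21/H21/H21/Prelude/ArithGeomL/FunctionFieldDivisors.lean @ 5238f0e (interim HEAD d8f2665); M5 mechanical rewrite
/-!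
# Places, divisors and Riemann–Roch spaces of a field extension `F/K`
(trunk ArithGeomL, item C5 `FunctionFieldDivisors`; notion `curve_genus`, part 1)

For a field extension `F/K` (intended: an algebraic function field of one variable, i.e.
`trdeg_K F = 1` and `F/K` finitely generated — these hypotheses only enter the *theorems*, see
`FunctionFieldGenus`) we set up, following Stichtenoth, *Algebraic Function Fields and Codes*,
§§I.1–I.4 and Rosen, *Number Theory in Function Fields*, Ch. 5:

* `PlaceOver K F`: places of `F/K`, i.e. valuation subrings `K ⊆ O ⊊ F` which are discrete
  valuation rings (the DVR conjunct is redundant for function fields — Stichtenoth I.1.6 — and is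
  only recorded to obtain a `sorry`-free `IsDiscreteValuationRing` instance, the same device as
  the G16 structure `Literature.NumberTheory.EllipticCurves.FunctionField.Place`);
* `PlaceOver.uniformizer`, `PlaceOver.valuation`, `PlaceOver.residueField` (a `K`-algebra: the
  instance `PlaceOver.algebraK : Algebra K O_v` is new, and the `K`-algebra / `K`-module structure
  on the residue field is then Mathlib's `IsLocalRing.ResidueField.algebra` /
  `IsLocalRing.instModuleResidueFieldOfAlgebra` — no instance is duplicated here),
  `PlaceOver.degree`, `PlaceOver.IsRational`, `PlaceOver.ord` (normalised `ℤ`-valued order);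
* `Divisor K F := PlaceOver K F →₀ ℤ`, `Divisor.degree : Divisor K F →+ ℤ`, `Divisor.IsEffective`,
  `principalDivisor K x`, `Divisor.IsPrincipal`, `Divisor.IsLinearlyEquivalent` (the outline's
  `LinearlyEquivalent`, renamed to the `Is…` predicate convention);
* `riemannRochSpace D : Submodule K F` (the space `L(D) = {x | (x) + D ≥ 0} ∪ {0}`, a genuine
  `K`-submodule), `ell D = dim_K L(D)`.

## Relation to G16 (`Literature.FunctionField`, files `FunctionFieldPlaces`, `FunctionFieldEllipticL`)

This file lives in the *fresh* namespace `Literature.AlgFunctionField`, so that no fully qualified name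
coincides with G16's `Literature.NumberTheory.EllipticCurves.FunctionField.Place`, `.ord`, `.degree`, … and files importing both
compile. For a global function field `F ⊋ 𝔽_q`, every valuation subring of `F` contains `𝔽_q`
(its elements are roots of unity or `0`), so `PlaceOver Fq F ≃ Literature.FunctionField.Place F`; the
bijection is stated in `FunctionFieldGenus`. The constant-field conventions differ: G16 uses
`IsFullConstantField` (`algebraicClosure Fq F = ⊥`), here the intended hypothesis is Mathlib's
`IsIntegrallyClosedIn K F`; for algebraic elements the two agree (remark, no statement needed
here).

## Mathlib anchors and searches

`ValuationSubring`, `ValuationSubring.valuation`, `IsDiscreteValuationRing`,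
`IsDiscreteValuationRing.exists_irreducible`, `IsDiscreteValuationRing.addVal`,
`IsLocalRing.ResidueField`, `Module.finrank`, `Finsupp.liftAddHom`, `Algebra.trdeg`,
`IntermediateField.FG`, `IsLocalRing.ResidueField.algebra`. Mathlib has no places of a general
extension `F/K`, no divisors of a function field and no Riemann–Roch spaces (searched:
`riemannRoch`, `RiemannRoch`, `Divisor` in `RingTheory`/`NumberTheory`/`FieldTheory` — only
`Mathlib.NumberTheory.FunctionField` with the place at infinity of `Fq(T)`), so everything below
is new. `uniformizer` is a `choose`d irreducible of the DVR `O_v`; whoever proves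
`ord_uniformizer` / `valuation_le_pow_iff` may want Mathlib's predicate `Valuation.IsUniformizer`
(`Mathlib/RingTheory/Valuation/Discrete/Basic.lean`, for `IsRankOneDiscrete` valuations) and the
bridge `IsDiscreteValuationRing` ↔ discrete valuation there.

## Design notes / junk values (each killed by a theorem in `FunctionFieldGenus`)

* `PlaceOver.degree v = 0` if the residue field is infinite-dimensional over `K` (never for
  function fields of one variable: `finiteDimensional_residueField`).
* `PlaceOver.ord v 0 = 0` (`addVal 0 = ⊤`, `⊤.toNat = 0`).
* `principalDivisor x = 0` if `{v | ord_v x ≠ 0}` is infinite (never for `x ≠ 0` in a function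
  field: `finite_setOf_ord_ne_zero`); also `principalDivisor 0 = 0`.
* `ell D = 0` if `L(D)` is infinite-dimensional (never in a function field:
  `finiteDimensional_riemannRochSpace`).
* The closing theorems `ell_eq_zero_of_deg_lt_zero` and `degree_principalDivisor` carry the
  function-field hypotheses `(hF : Algebra.trdeg K F = 1) (hfg : (⊤ : IntermediateField K F).FG)`
  explicitly, to avoid a forward dependency on the class `IsAlgFunctionField` of
  `FunctionFieldGenus`; `ell_congr_of_isLinearlyEquivalent` holds for any `F/K` (multiplication
  by `x` is a `K`-linear isomorphism `L(D) ≃ L(D')`) and carries none.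
* Only `PlaceOver.ord` (case split on `x ∈ O_v`) and `principalDivisor` use classical
  decidability, each via a local `open Classical in`; no file-wide `open scoped Classical`.

## References

* H. Stichtenoth, *Algebraic Function Fields and Codes*, GTM 254, §§I.1–I.4.
* M. Rosen, *Number Theory in Function Fields*, GTM 210, Ch. 5.
-/

noncomputable section

namespace Literature.NumberTheory.DiophantineGeometry.AlgFunctionField

universe u v

variable (K : Type u) (F : Type v) [Field K] [Field F] [Algebra K F]

/-- A *place* of the extension `F/K`: a valuation subring `O` of `F` with `K ⊆ O ⊊ F` which is a
discrete valuation ring (Stichtenoth, Def. I.1.8 and Thm. I.1.6; Rosen Ch. 5). For an algebraic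
function field of one variable the DVR condition is automatic (Stichtenoth I.1.6); it is recorded
as a field only to make the `IsDiscreteValuationRing` instance `sorry`-free. Two places are equal
iff their valuation rings are (`PlaceOver.ext`, generated by `@[ext]`). [folklore] -/
@[ext]
structure PlaceOver where
  /-- The valuation ring `O_v ⊆ F` of the place. -/
  toValuationSubring : ValuationSubring F
  /-- The valuation ring is a proper subring of `F`. -/
  ne_top : toValuationSubring ≠ ⊤
  /-- The valuation ring is a discrete valuation ring. -/
  isDVR : IsDiscreteValuationRing toValuationSubring
  /-- The valuation ring contains the constant field `K`. -/
  algebraMap_mem : ∀ c : K, algebraMap K F c ∈ toValuationSubring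

variable {K F}

namespace PlaceOver

/-- The valuation ring of a place is a discrete valuation ring (by definition; Stichtenoth
Thm. I.1.6). [folklore] -/
instance instIsDiscreteValuationRing (v : PlaceOver K F) :
    IsDiscreteValuationRing v.toValuationSubring :=
  v.isDVR

/-- A uniformizer (prime element, local parameter) `π_v` of the place `v`: a chosen irreducible
element of the DVR `O_v` (Stichtenoth I.1.6, via `IsDiscreteValuationRing.exists_irreducible`). [folklore] -/
def uniformizer (v : PlaceOver K F) : v.toValuationSubring :=
  (IsDiscreteValuationRing.exists_irreducible v.toValuationSubring).choose

/-- The chosen uniformizer is irreducible (Stichtenoth I.1.6). [folklore] -/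
theorem irreducible_uniformizer (v : PlaceOver K F) : Irreducible v.uniformizer :=
  (IsDiscreteValuationRing.exists_irreducible v.toValuationSubring).choose_spec

/-- The valuation of `F` attached to the place `v` (Mathlib's `ValuationSubring.valuation`, with
values in the value group of `O_v`; Stichtenoth I.1.11). [folklore] -/
abbrev valuation (v : PlaceOver K F) : Valuation F v.toValuationSubring.ValueGroup :=
  v.toValuationSubring.valuation

/-- The constant field `K` maps into the valuation ring `O_v` (since `K ⊆ O_v` by definition of a
place; Stichtenoth I.1.5). No Mathlib instance of this shape exists (the target is a field of a
structure defined here), so nothing is overridden. [folklore] -/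
instance algebraK (v : PlaceOver K F) : Algebra K v.toValuationSubring :=
  ((algebraMap K F).codRestrict v.toValuationSubring v.algebraMap_mem).toAlgebra

/-- The structure map `K → O_v` is the restriction of `K → F`. [folklore] -/
@[simp]
theorem algebraMap_toValuationSubring_apply (v : PlaceOver K F) (c : K) :
    ((algebraMap K v.toValuationSubring c : v.toValuationSubring) : F) = algebraMap K F c :=
  rfl

/-- `K → O_v → F` is a scalar tower. [folklore] -/
instance instIsScalarTowerValuationSubring (v : PlaceOver K F) :
    IsScalarTower K v.toValuationSubring F :=
  IsScalarTower.of_algebraMap_eq fun _ ↦ rfl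

/-- The residue field `F_v = O_v / m_v` of the place `v` (Stichtenoth Def. I.1.13), Mathlib's
`IsLocalRing.ResidueField`. It is a `K`-algebra via `K → O_v → O_v/m_v` (Stichtenoth I.1.14: `K`
embeds into `F_v`); this structure is *Mathlib's* `IsLocalRing.ResidueField.algebra` (with the
scalar tower `IsScalarTower K O_v F_v` and `Module K F_v` also from Mathlib), fed by `algebraK`;
no instance is declared here. [folklore] -/
abbrev residueField (v : PlaceOver K F) : Type v :=
  IsLocalRing.ResidueField v.toValuationSubring

/-- The `K`-algebra map into the residue field is `K → O_v → O_v/m_v` (unfolding of Mathlib's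
`IsLocalRing.ResidueField.algebra`). [folklore] -/
theorem algebraMap_residueField_apply (v : PlaceOver K F) (c : K) :
    algebraMap K v.residueField c =
      IsLocalRing.residue v.toValuationSubring (algebraMap K v.toValuationSubring c) :=
  rfl

/-- The degree `deg v = [F_v : K]` of the place `v` (Stichtenoth Def. I.1.14). Junk value `0` if
the residue field is infinite-dimensional over `K`; for an algebraic function field of one
variable it is always finite (Stichtenoth Prop. I.1.15, `finiteDimensional_residueField` in
`FunctionFieldGenus`). [folklore] -/
def degree (v : PlaceOver K F) : ℕ :=
  Module.finrank K v.residueField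

/-- A place is *rational* (of degree one) if `[F_v : K] = 1`, i.e. `F_v = K`
(Stichtenoth Def. I.1.14). [folklore] -/
def IsRational (v : PlaceOver K F) : Prop :=
  v.degree = 1

/-- The normalised discrete valuation `ord_v : F → ℤ` of the place `v` (Stichtenoth I.1.11,
`v_P`): for `x ∈ O_v` it is `addVal x` (so `ord_v π_v = 1`), for `x ∉ O_v` it is
`-addVal (x⁻¹)`. Junk value `ord_v 0 = 0` (Stichtenoth sets `v_P(0) = ∞`). [folklore] -/
def ord (v : PlaceOver K F) (x : F) : ℤ :=
  open Classical in
  if hx : x ∈ v.toValuationSubring then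
    ((IsDiscreteValuationRing.addVal v.toValuationSubring ⟨x, hx⟩).toNat : ℤ)
  else
    -((IsDiscreteValuationRing.addVal v.toValuationSubring
        ⟨x⁻¹, (v.toValuationSubring.mem_or_inv_mem x).resolve_left hx⟩).toNat : ℤ)

/-- `ord_v (x y) = ord_v x + ord_v y` for `x, y ≠ 0` (Stichtenoth I.1.11, (2)). [cite: Stichtenoth2009, I.1.11 (2)] -/
def ord_mul : Prop :=
  ∀ (v : PlaceOver K F) {x y : F} (hx : x ≠ 0) (hy : y ≠ 0),
    v.ord (x * y) = v.ord x + v.ord y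

/-- The ultrametric inequality `ord_v (x + y) ≥ min (ord_v x) (ord_v y)` for `x, y, x + y ≠ 0`
(Stichtenoth I.1.11, (3)); the nonvanishing hypotheses avoid the junk value `ord_v 0 = 0`. [cite: Stichtenoth2009, I.1.11 (3)] -/
def min_ord_le_ord_add : Prop :=
  ∀ (v : PlaceOver K F) {x y : F} (hx : x ≠ 0) (hy : y ≠ 0) (hxy : x + y ≠ 0),
    min (v.ord x) (v.ord y) ≤ v.ord (x + y)

/-- Nonzero constants have order `0` at every place (Stichtenoth I.1.5 / I.1.11 (5)). [cite: Stichtenoth2009, I.1.5 and I.1.11 (5)] -/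
def ord_algebraMap : Prop :=
  ∀ (v : PlaceOver K F) {c : K} (hc : c ≠ 0),
    v.ord (algebraMap K F c) = 0

/-- A uniformizer has order `1` (Stichtenoth I.1.11 (4)). [cite: Stichtenoth2009, I.1.11 (4)] -/
def ord_uniformizer : Prop :=
  ∀ (v : PlaceOver K F),
    v.ord (v.uniformizer : F) = 1

/-- Comparison of the abstract valuation with `ord_v`: for `x ≠ 0` and `n : ℤ`,
`v(x) ≤ v(π_v) ^ n ↔ n ≤ ord_v x` (Stichtenoth I.1.6, I.1.11: `x = u π_vⁿ` with `u` a unit). [cite: Stichtenoth2009, I.1.6 and I.1.11] -/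
def valuation_le_pow_iff : Prop :=
  ∀ (v : PlaceOver K F) {x : F} (hx : x ≠ 0) (n : ℤ),
    v.valuation x ≤ v.valuation (v.uniformizer : F) ^ n ↔ n ≤ v.ord x

end PlaceOver

/-! ### Divisors -/

variable (K F) in
/-- The divisor group `Div(F/K)`: the free abelian group on the places of `F/K`, realised as
finitely supported functions `PlaceOver K F →₀ ℤ` (Stichtenoth Def. I.4.1; Rosen Ch. 5). [folklore] -/
abbrev Divisor : Type v :=
  PlaceOver K F →₀ ℤ

namespace Divisor

/-- The degree homomorphism `deg : Div(F/K) →+ ℤ`, `deg D = ∑_v D(v) · deg v`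
(Stichtenoth Def. I.4.1). [folklore] -/
def degree : Divisor K F →+ ℤ :=
  Finsupp.liftAddHom fun v ↦ AddMonoidHom.mulRight (v.degree : ℤ)

/-- `deg (n · v) = n · deg v` (Stichtenoth Def. I.4.1). [folklore] -/
@[simp]
theorem degree_single (v : PlaceOver K F) (n : ℤ) :
    degree (Finsupp.single v n) = n * v.degree := by
  simp [degree]

/-- `deg D = ∑_{v ∈ supp D} D(v) · deg v` (Stichtenoth Def. I.4.1). [folklore] -/
theorem degree_apply (D : Divisor K F) :
    degree D = D.sum fun v n ↦ n * (v.degree : ℤ) := by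
  simp [degree, Finsupp.liftAddHom_apply]

/-- A divisor is *effective* (`D ≥ 0`) if all its coefficients are nonnegative
(Stichtenoth Def. I.4.1). [folklore] -/
def IsEffective (D : Divisor K F) : Prop :=
  ∀ v, 0 ≤ D v

/-- `D` is effective iff `0 ≤ D` in the pointwise order of `PlaceOver K F →₀ ℤ`. [folklore] -/
theorem isEffective_iff_nonneg (D : Divisor K F) : D.IsEffective ↔ 0 ≤ D :=
  Iff.rfl

end Divisor

variable (K) in
/-- The principal divisor `(x) = ∑_v ord_v(x) · v` of `x ∈ F` (Stichtenoth Def. I.4.2). Junk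
value `0` when `{v | ord_v x ≠ 0}` is infinite, which never happens for `x ≠ 0` in an algebraic
function field of one variable (Stichtenoth Cor. I.3.4, `finite_setOf_ord_ne_zero` in
`FunctionFieldGenus`); also `principalDivisor K 0 = 0` by the junk value `ord_v 0 = 0`. The
constant field `K` is an explicit argument (it cannot be inferred from `x : F`). [folklore] -/
def principalDivisor (x : F) : Divisor K F :=
  open Classical in
  if h : {v : PlaceOver K F | v.ord x ≠ 0}.Finite then
    Finsupp.ofSupportFinite (fun v ↦ v.ord x) h
  else 0

/-- Off the junk case, the coefficient of `(x)` at `v` is `ord_v x` (Stichtenoth Def. I.4.2). [folklore] -/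
theorem principalDivisor_apply {x : F} (h : {v : PlaceOver K F | v.ord x ≠ 0}.Finite)
    (v : PlaceOver K F) : principalDivisor K x v = v.ord x := by
  simp only [principalDivisor, dif_pos h]
  rfl

namespace Divisor

/-- A divisor is *principal* if it is the divisor of a nonzero function
(Stichtenoth Def. I.4.2). [folklore] -/
def IsPrincipal (D : Divisor K F) : Prop :=
  ∃ x : F, x ≠ 0 ∧ principalDivisor K x = D

/-- Two divisors are *linearly equivalent*, `D ∼ D'`, if `D - D'` is principal
(Stichtenoth Def. I.4.2; the outline's `LinearlyEquivalent`, named as an `Is…` predicate). This is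
an equivalence relation only under the function-field hypotheses (there principal divisors form a
subgroup, Stichtenoth I.4.3); for a general `F/K` the junk value of `principalDivisor` may break
transitivity. [folklore] -/
def IsLinearlyEquivalent (D D' : Divisor K F) : Prop :=
  IsPrincipal (D - D')

end Divisor

/-! ### Riemann–Roch spaces -/

/-- The Riemann–Roch space `L(D) = {x ∈ F | (x) + D ≥ 0} ∪ {0}` of a divisor `D`, as a
`K`-subspace of `F` (Stichtenoth Def. I.4.4, Lemma I.4.6). The carrier is phrased through the
abstract valuations: `x ∈ L(D) ↔ ∀ v, v(x) ≤ v(π_v) ^ (-D v)`, which for `x ≠ 0` says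
`ord_v x ≥ -D(v)` (`mem_riemannRochSpace_iff_ord`) and holds trivially for `x = 0`. [folklore] -/
def riemannRochSpace (D : Divisor K F) : Submodule K F where
  carrier := {x | ∀ v : PlaceOver K F, v.valuation x ≤ v.valuation (v.uniformizer : F) ^ (-(D v))}
  zero_mem' v := by simp
  add_mem' {x y} hx hy v :=
    (Valuation.map_add _ x y).trans (max_le (hx v) (hy v))
  smul_mem' c {x} hx v := by
    rw [Algebra.smul_def, Valuation.map_mul]
    exact (mul_le_of_le_one_left'
      (v.toValuationSubring.valuation_le_one ⟨_, v.algebraMap_mem c⟩)).trans (hx v)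

/-- Membership in `L(D)` (definitional unfolding). [folklore] -/
theorem mem_riemannRochSpace_iff (D : Divisor K F) (x : F) :
    x ∈ riemannRochSpace D ↔
      ∀ v : PlaceOver K F, v.valuation x ≤ v.valuation (v.uniformizer : F) ^ (-(D v)) :=
  Iff.rfl

/-- For `x ≠ 0`: `x ∈ L(D) ↔ ∀ v, ord_v x ≥ -D(v)`, i.e. `(x) + D ≥ 0`
(Stichtenoth Def. I.4.4). [folklore] -/
def mem_riemannRochSpace_iff_ord : Prop :=
  ∀ (D : Divisor K F) {x : F} (hx : x ≠ 0),
    x ∈ riemannRochSpace D ↔ ∀ v : PlaceOver K F, -D v ≤ v.ord x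

/- interim proof relied on results that are now named facts (D-0014); demoted to a fact by the M5 import, proof preserved:
:= by
  simp only [mem_riemannRochSpace_iff, PlaceOver.valuation_le_pow_iff _ hx]
-/

/-- `D ≤ D' → L(D) ≤ L(D')` (Stichtenoth Lemma I.4.6 (b) / I.4.8). [folklore] -/
theorem riemannRochSpace_mono {D D' : Divisor K F} (h : D ≤ D') :
    riemannRochSpace D ≤ riemannRochSpace D' := by
  intro x hx v
  refine (hx v).trans ?_
  have hπ : v.valuation (v.uniformizer : F) ≤ 1 := v.toValuationSubring.valuation_le_one _
  have h0 : 0 < v.valuation (v.uniformizer : F) :=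
    (Valuation.pos_iff _).2 fun h ↦
      v.irreducible_uniformizer.ne_zero (Subtype.ext h)
  exact zpow_le_zpow_right_of_le_one₀ h0 hπ (neg_le_neg (h v))

/-- Constants lie in `L(0)`: `K ⊆ L(0)` (Stichtenoth Lemma I.4.7 (a): in fact `L(0) = K` when
`K` is the full constant field of a function field). [folklore] -/
theorem algebraMap_mem_riemannRochSpace_zero (c : K) :
    algebraMap K F c ∈ riemannRochSpace (0 : Divisor K F) := by
  intro v
  simpa using v.toValuationSubring.valuation_le_one ⟨_, v.algebraMap_mem c⟩

/-- The dimension `ℓ(D) = dim_K L(D)` of the Riemann–Roch space (Stichtenoth Def. I.4.4).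
Junk value `0` if `L(D)` is infinite-dimensional, which never happens for an algebraic function
field of one variable (Stichtenoth Prop. I.4.9, `finiteDimensional_riemannRochSpace` in
`FunctionFieldGenus`). [folklore] -/
def ell (D : Divisor K F) : ℕ :=
  Module.finrank K (riemannRochSpace D)

/-! ### Basic theorems (function fields of one variable) -/

/-- If `deg D < 0` then `ℓ(D) = 0`, for an algebraic function field of one variable `F/K`
(Stichtenoth Cor. I.4.12 (a)). The function-field hypotheses are explicit to avoid a forward
dependency on `IsAlgFunctionField` (`FunctionFieldGenus`). [cite: Stichtenoth2009, Cor. I.4.12(a)] -/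
def ell_eq_zero_of_deg_lt_zero : Prop :=
  ∀ (hF : Algebra.trdeg K F = 1) (hfg : (⊤ : IntermediateField K F).FG) {D : Divisor K F} (hD : D.degree < 0),
    ell D = 0

/-- Linearly equivalent divisors have Riemann–Roch spaces of the same dimension:
`D ∼ D' → ℓ(D) = ℓ(D')` (Stichtenoth Lemma I.4.6 (b), Def. I.4.4). No function-field hypotheses
are needed: if `D - D' = (x)` off the junk case, `y ↦ x y` is a `K`-linear isomorphism
`L(D) ≃ L(D')` by `ord_mul`; in the junk case `(x) = 0` forces `D = D'`. [cite: Stichtenoth2009, Lemma I.4.6(b)] -/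
def ell_congr_of_isLinearlyEquivalent : Prop :=
  ∀ {D D' : Divisor K F} (h : D.IsLinearlyEquivalent D'),
    ell D = ell D'

/-- Principal divisors have degree zero: `deg (x) = 0` for `x ≠ 0` in an algebraic function
field of one variable (Stichtenoth Thm. I.4.11, Cor. I.4.12; Rosen Prop. 5.1). [cite: Stichtenoth2009, Thm. I.4.11] -/
def degree_principalDivisor : Prop :=
  ∀ (hF : Algebra.trdeg K F = 1) (hfg : (⊤ : IntermediateField K F).FG) {x : F} (hx : x ≠ 0),
    (principalDivisor K x).degree = 0

end Literature.NumberTheory.DiophantineGeometry.AlgFunctionField
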